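import Summits.Ventures.Crystal3D.Theorems.StickyWulffConstantGenericWallFloorStarFarSearch
import Summits.Ventures.Crystal3D.Theorems.StickyWulffConstantGenericWallFloorStarFarTasks1
import Summits.Ventures.Crystal3D.Theorems.StickyWulffConstantGenericWallFloorStarFarTasks2
import Summits.Ventures.Crystal3D.Theorems.StickyWulffConstantGenericWallFloorStarFarTasks3
import Summits.Ventures.Crystal3D.Theorems.StickyWulffConstantGenericWallFloorStarFarTasks4
import Summits.Ventures.Crystal3D.Theorems.StickyWulffConstantGenericWallFloorStarFarTasks5
import Summits.Ventures.Crystal3D.Theorems.StickyWulffConstantGenericWallFloorStarFarTasks6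
import Summits.Ventures.Crystal3D.Theorems.StickyWulffConstantGenericWallFloorStarFarTasks7
import Summits.Ventures.Crystal3D.Theorems.StickyWulffConstantGenericWallFloorStarFarTasks8
import Summits.Ventures.Crystal3D.Theorems.StickyWulffConstantGenericWallFloorDoubleTopLocalCoaxial
import HarnessLib

/-!
# Kernel discharge of `StarPairFar`, final part: **`starPairFar_holds : StarPairFar`** (computational grade)

HONEST FRAMING. Venture `Summits/Ventures/Crystal3D` (cell `crystal3d-full`), helper `--supports` the crux
`GenericWallFloor` (stmt-Ventures-19480) of `route-Ventures-StickyWulffConstant`, line `WallLedgerG`.  Rung credit only;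
F-C1 not moved.  Assembly of R1: the task files (`tasks1_ok … tasks8_ok`, `native_decide`) evaluate the self-recomputing
branch and bound on all `2048` top tasks (`checkTask_all`); part 5 turns each into `Goal` for every real quaternion of the
top box; here the geometry is bridged:

* `cubicMat R` is orthogonal, so `det = ±1`; an improper `R` is replaced by `swapMirror ≫ R` (the bond mirror permutes the
  star, second clause of `StarPairFar`) — `false_of_proper` does the proper case;
* Milestone 1 (`exists_quat_of_orthogonal_det_one`, p626276): `cubicMat R = N(q)/|q|²`; sup-norm chart normalisation
  `q ↦ (SC/q_c)·q` (`q_c` a largest coordinate) puts `q` in a top box of chart `c` (`exists_topBox_mem`);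
* the hypotheses of `StarPairFar` are exactly `Sph`, `H1`, `H3`, `H4` in the `× √2` cubic frame (`√2·cubicCoords (wPt i) =
  clusterInt i`, distances via `sqrt_two_smul_cubicCoords_dot_self`, `|M v|² = |v|²`), and `Ball c` is exactly
  `InCertBall R y c` (`‖M Bᵀ − 1‖_F² = 6 − 2 Σ M_ab B_ab` for orthogonal `M`, `B`; `2‖y − y₀‖² = |Y − y₀|²`).
Hence **`StarPairFar` is a theorem of the tree at computational grade** (trust base: `Lean.ofReduceBool` for the eight
evaluations and `allCertOK_ok`; everything else on the standard axioms), and with it `starPairCoaxial_holds`.  Before this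
file `StarPairFar` was a named hypothesis certified twice OUTSIDE the kernel (lit g13 kit j298152–5; wulff-p2 g10 kit j298800).
WHAT THIS IS NOT: `P5Exhaustion` (the other certified input of lane G) is untouched; no statement about the residual
`GenericWallFloorCoreResidualTilt`; F-C1 not moved.
-/

namespace Summit.Ventures.Crystal3D.Theorems.StarFar

open Summit.Ventures.Crystal3D.Theorems.NearIdentity Matrix
open scoped InnerProductSpace

/-! ### The evaluations, assembled -/

/-- The 46 star certificates pass the faithfulness checks (evaluation). -/
theorem allCertOK_ok : allCertOK = true := by
  native_decide

/-- The eight task files together list every task (evaluation of a finite inclusion). -/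
theorem tasks_cover : ∀ t : Task, t ∈ tasks1 ++ tasks2 ++ tasks3 ++ tasks4 ++ tasks5 ++ tasks6 ++ tasks7 ++ tasks8 := by
  native_decide

/-- **Every top task passes the branch and bound.** -/
theorem checkTask_all (t : Task) : checkTask t = true := by
  have hall : (tasks1 ++ tasks2 ++ tasks3 ++ tasks4 ++ tasks5 ++ tasks6 ++ tasks7 ++ tasks8).all checkTask = true := by
    simp only [List.all_append, Bool.and_eq_true]
    exact ⟨⟨⟨⟨⟨⟨⟨tasks1_ok, tasks2_ok⟩, tasks3_ok⟩, tasks4_ok⟩, tasks5_ok⟩, tasks6_ok⟩, tasks7_ok⟩, tasks8_ok⟩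
  rw [List.all_eq_true] at hall
  exact hall t (tasks_cover t)

/-! ### Algebraic bridges -/

/-- Homogeneity of the quaternion matrix. -/
theorem quatMat_smul (t w x y z : ℝ) :
    quatMat (t * w) (t * x) (t * y) (t * z) = (t ^ 2) • quatMat w x y z := by
  ext a b
  fin_cases a <;> fin_cases b <;> simp [quatMat] <;> ring

/-- Homogeneity of `|q|²`. -/
theorem nrm_smul (t w x y z : ℝ) : nrm (t * w) (t * x) (t * y) (t * z) = t ^ 2 * nrm w x y z := by
  unfold nrm; ring

/-- `|M v|² = |v|²` for `Mᵀ M = 1`. -/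
theorem dot_mulVec_self {M : Matrix (Fin 3) (Fin 3) ℝ} (hO : Mᵀ * M = 1) (v : Fin 3 → ℝ) :
    (M *ᵥ v) ⬝ᵥ (M *ᵥ v) = v ⬝ᵥ v := by
  rw [dotProduct_mulVec, ← vecMul_transpose, vecMul_vecMul, hO, vecMul_one]

/-- `‖κ‖_F² = tr(κ κᵀ)`. -/
theorem frob_eq_trace (κ : Matrix (Fin 3) (Fin 3) ℝ) : frob κ = Matrix.trace (κ * κᵀ) := by
  simp only [frob, Matrix.trace, Matrix.diag_apply, Matrix.mul_apply, Matrix.transpose_apply, pow_two]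

/-- `‖M Bᵀ − 1‖_F² = 6 − 2 Σ M_ab B_ab` for orthogonal `M`, `B`. -/
theorem frob_orth {M B : Matrix (Fin 3) (Fin 3) ℝ} (hM : M * Mᵀ = 1) (hB : Bᵀ * B = 1) :
    frob (M * Bᵀ - 1) = 6 - 2 * ∑ a : Fin 3, ∑ b : Fin 3, M a b * B a b := by
  rw [frob_eq_trace]
  have e : (M * Bᵀ - 1)ᵀ = B * Mᵀ - 1 := by
    rw [Matrix.transpose_sub, Matrix.transpose_one, Matrix.transpose_mul, Matrix.transpose_transpose]
  have e2 : M * Bᵀ * (B * Mᵀ) = 1 := by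
    rw [Matrix.mul_assoc, ← Matrix.mul_assoc Bᵀ, hB, Matrix.one_mul, hM]
  have h1 : (M * Bᵀ - 1) * (M * Bᵀ - 1)ᵀ = 1 + 1 - M * Bᵀ - B * Mᵀ := by
    rw [e, sub_mul, mul_sub, mul_sub, e2, Matrix.mul_one, Matrix.one_mul, Matrix.one_mul]
    abel
  have htr : (B * Mᵀ).trace = (M * Bᵀ).trace := by
    rw [← Matrix.trace_transpose, Matrix.transpose_mul, Matrix.transpose_transpose]
  have hMB : (M * Bᵀ).trace = ∑ a : Fin 3, ∑ b : Fin 3, M a b * B a b := by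
    simp only [Matrix.trace, Matrix.diag_apply, Matrix.mul_apply, Matrix.transpose_apply]
  rw [h1, Matrix.trace_sub, Matrix.trace_sub, Matrix.trace_add, Matrix.trace_one, Fintype.card_fin, htr, hMB]
  push_cast
  ring

/-- The walk cluster in the `× √2` frame is the integer table: `fR i = FZ i`. -/
theorem fR_eq_FZ (i : Fin 13) : fR i = fun a => (FZ i a : ℝ) := by
  funext a; simp [fR, castVec, clusterQ, FZ]

/-- `Fᵢᵀ N Fⱼ` as a dot product. -/
theorem FNF_eq_dot (i j : Fin 13) (w x y z : ℝ) :
    FNF i j w x y z = (fun a => (FZ i a : ℝ)) ⬝ᵥ (quatMat w x y z *ᵥ fun a => (FZ j a : ℝ)) := by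
  simp only [FNF, dotProduct, Matrix.mulVec, Fin.sum_univ_three]; ring

/-- `(N Fⱼ)_a`. -/
theorem NF_eq_mulVec (j : Fin 13) (a : Fin 3) (w x y z : ℝ) :
    NF j a w x y z = (quatMat w x y z *ᵥ fun b => (FZ j b : ℝ)) a := by
  simp only [NF, Matrix.mulVec, dotProduct]

/-- Star balls have `|F|² = 2`. -/
theorem FZ_dot_self {i : Fin 13} (hi : i ∈ starIdx) :
    (fun a => (FZ i a : ℝ)) ⬝ᵥ (fun a => (FZ i a : ℝ)) = 2 := by
  have h := (mem_starIdx_iff_norm i).1 hi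
  have hc : ((dotQ (clusterQ i) (clusterQ i) : ℚ) : ℝ) = 2 := by rw [h]; norm_num
  simpa [dotQ, clusterQ, FZ, dotProduct, Fin.sum_univ_three] using hc

/-- `2·dist² = |√2 c(u) − √2 c(v)|²`. -/
theorem two_mul_dist_sq (u v : EuclideanSpace ℝ (Fin 3)) :
    2 * dist u v ^ 2 = (Real.sqrt 2 • cubicCoords u - Real.sqrt 2 • cubicCoords v) ⬝ᵥ
      (Real.sqrt 2 • cubicCoords u - Real.sqrt 2 • cubicCoords v) := by
  rw [dist_eq_norm, ← sqrt_two_smul_cubicCoords_dot_self, cubicCoords_sub, smul_sub]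

/-- `√2·cubicCoords (R w) = cubicMat R · (√2·cubicCoords w)`. -/
theorem sqrt_two_cubicCoords_map (R : EuclideanSpace ℝ (Fin 3) ≃ₗᵢ[ℝ] EuclideanSpace ℝ (Fin 3))
    (w : EuclideanSpace ℝ (Fin 3)) :
    Real.sqrt 2 • cubicCoords (R w) = cubicMat R *ᵥ (Real.sqrt 2 • cubicCoords w) := by
  rw [cubicCoords_eq_cubicMat_mulVec, Matrix.mulVec_smul]

/-! ### The proper case -/

/-- Sup-norm chart normalisation of a nonzero quaternion representing `M`. -/
theorem exists_chart {M : Matrix (Fin 3) (Fin 3) ℝ} {w x y z : ℝ} (h0 : 0 < w ^ 2 + x ^ 2 + y ^ 2 + z ^ 2)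
    (hqM : quatMat w x y z = (w ^ 2 + x ^ 2 + y ^ 2 + z ^ 2) • M) :
    ∃ (c : Fin 4) (p : Fin 4 → ℝ), p c = SC ∧ (∀ k, |p k| ≤ SC) ∧
      quatMat (p 0) (p 1) (p 2) (p 3) = nrm (p 0) (p 1) (p 2) (p 3) • M := by
  have hS := SC_spec.1
  set qv : Fin 4 → ℝ := ![w, x, y, z] with hqv
  obtain ⟨c, -, hc⟩ := Finset.exists_max_image Finset.univ (fun k => |qv k|) Finset.univ_nonempty
  have hqc : qv c ≠ 0 := by
    intro hz
    have hall : ∀ k, qv k = 0 := fun k =>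
      abs_eq_zero.1 (le_antisymm (by simpa [hz] using hc k (Finset.mem_univ k)) (abs_nonneg _))
    have e0 := hall 0; have e1 := hall 1; have e2 := hall 2; have e3 := hall 3
    rw [hqv] at e0 e1 e2 e3
    simp only [Matrix.cons_val_zero, Matrix.cons_val_one, Matrix.head_cons, Matrix.cons_val_two,
      Matrix.tail_cons, Matrix.cons_val_three] at e0 e1 e2 e3
    rw [e0, e1, e2, e3] at h0; norm_num at h0
  set t : ℝ := (SC : ℝ) / qv c with ht
  refine ⟨c, fun k => t * qv k, ?_, fun k => ?_, ?_⟩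
  · show t * qv c = SC
    rw [ht]; field_simp
  · show |t * qv k| ≤ SC
    rw [abs_mul]
    calc |t| * |qv k| ≤ |t| * |qv c| := mul_le_mul_of_nonneg_left (hc k (Finset.mem_univ k)) (abs_nonneg t)
      _ = |t * qv c| := (abs_mul t (qv c)).symm
      _ = SC := by rw [ht, div_mul_cancel₀ _ hqc]; exact abs_of_pos hS
  · show quatMat (t * w) (t * x) (t * y) (t * z) = nrm (t * w) (t * x) (t * y) (t * z) • M
    rw [quatMat_smul, nrm_smul, hqM, smul_smul, nrm]

/-- **The proper case.**  For `det (cubicMat R) = 1`: the star hypotheses of `StarPairFar` and «outside every star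
certificate ball» are contradictory. -/
theorem false_of_proper (R : EuclideanSpace ℝ (Fin 3) ≃ₗᵢ[ℝ] EuclideanSpace ℝ (Fin 3)) (y : EuclideanSpace ℝ (Fin 3))
    (hdet : (cubicMat R).det = 1)
    (hclus : ∀ i ∈ starIdx, ∀ j ∈ starIdx, wPt i = R (wPt j) ∨ 1 ≤ dist (wPt i) (R (wPt j)))
    (hy : ‖y‖ = 1) (hyF : ∀ i ∈ starIdx, 1 ≤ dist y (wPt i)) (hyM : ∀ j ∈ starIdx, 1 ≤ dist y (R (wPt j)))
    (hfar : ∀ c ∈ starDtCerts, ¬ InCertBall R y c) : False := by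
  have hS := SC_spec.1
  set M := cubicMat R with hMdef
  have hO : Mᵀ * M = 1 := cubicMat_orth R
  have hO' : M * Mᵀ = 1 := cubicMat_orth' R
  obtain ⟨w, x, y', z, hq0, hqM⟩ := exists_quat_of_orthogonal_det_one M hO hdet
  obtain ⟨c, p, hpc, hpk, hN⟩ := exists_chart hq0 hqM
  obtain ⟨i, j, k, hx⟩ := exists_topBox_mem c hpc hpk
  have hn : 0 < nrm (p 0) (p 1) (p 2) (p 3) := nrm_pos_of_topBox c i j k hx
  set n := nrm (p 0) (p 1) (p 2) (p 3) with hndef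
  -- the eleventh ball in the × √2 frame, scaled by SC
  set Y : Fin 3 → ℝ := Real.sqrt 2 • cubicCoords y with hYdef
  have hYY : Y ⬝ᵥ Y = 2 := by rw [hYdef, sqrt_two_smul_cubicCoords_dot_self, hy]; norm_num
  have G := checkTask_sound allCertOK_ok (checkTask_all (c, i, j, k)) hx (SC * Y 0) (SC * Y 1) (SC * Y 2)
  -- the images of the star balls
  have himg : ∀ j : Fin 13, Real.sqrt 2 • cubicCoords (R (wPt j)) = M *ᵥ fun a => (FZ j a : ℝ) := by
    intro j; rw [sqrt_two_cubicCoords_map, sqrt_two_smul_cubicCoords_wPt, fR_eq_FZ]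
  have hfix : ∀ i : Fin 13, Real.sqrt 2 • cubicCoords (wPt i) = fun a => (FZ i a : ℝ) := by
    intro i; rw [sqrt_two_smul_cubicCoords_wPt, fR_eq_FZ]
  -- Sph
  have hYY3 : Y 0 * Y 0 + Y 1 * Y 1 + Y 2 * Y 2 = 2 := by
    simpa only [dotProduct, Fin.sum_univ_three] using hYY
  have hsph : Sph (SC * Y 0) (SC * Y 1) (SC * Y 2) := by
    unfold Sph
    have e : (SC : ℝ) * Y 0 * (SC * Y 0) + SC * Y 1 * (SC * Y 1) + SC * Y 2 * (SC * Y 2) =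
        SC * SC * (Y 0 * Y 0 + Y 1 * Y 1 + Y 2 * Y 2) := by ring
    rw [e, hYY3]; ring
  -- H1
  have h1 : H1 (p 0) (p 1) (p 2) (p 3) := by
    intro i hi j hj
    have hF2 := FZ_dot_self hi
    have hF2j := FZ_dot_self hj
    have hFNF : FNF i j (p 0) (p 1) (p 2) (p 3) =
        n * ((fun a => (FZ i a : ℝ)) ⬝ᵥ (M *ᵥ fun a => (FZ j a : ℝ))) := by
      rw [FNF_eq_dot, hN, Matrix.smul_mulVec, dotProduct_smul, smul_eq_mul]
    rcases hclus i hi j hj with h | h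
    · left
      have hv : (fun a => (FZ i a : ℝ)) = M *ᵥ fun a => (FZ j a : ℝ) := by
        have := congrArg (fun v => Real.sqrt 2 • cubicCoords v) h
        simpa only [hfix, himg] using this
      rw [hFNF, ← hv, hF2]; ring
    · right
      have hd := two_mul_dist_sq (wPt i) (R (wPt j))
      rw [hfix i, himg j, sub_dotProduct, dotProduct_sub, dotProduct_sub, hF2, dot_mulVec_self hO, hF2j,
        dotProduct_comm (M *ᵥ fun a => (FZ j a : ℝ))] at hd
      have h1' : 1 ≤ dist (wPt i) (R (wPt j)) ^ 2 := by nlinarith [h]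
      have hτ : (fun a => (FZ i a : ℝ)) ⬝ᵥ (M *ᵥ fun a => (FZ j a : ℝ)) ≤ 1 := by linarith
      rw [hFNF]
      nlinarith [hτ, hn]
  -- H3
  have h3 : H3 (SC * Y 0) (SC * Y 1) (SC * Y 2) := by
    intro i hi
    have hd := two_mul_dist_sq y (wPt i)
    rw [← hYdef, hfix i, sub_dotProduct, dotProduct_sub, dotProduct_sub, hYY, FZ_dot_self hi,
      dotProduct_comm (fun a => (FZ i a : ℝ)) Y] at hd
    have h1' : 1 ≤ dist y (wPt i) ^ 2 := by nlinarith [hyF i hi]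
    have hYF : Y ⬝ᵥ (fun a => (FZ i a : ℝ)) ≤ 1 := by linarith
    simp only [dotProduct, Fin.sum_univ_three] at hYF
    nlinarith [hYF, hS]
  -- H4
  have h4 : H4 (p 0) (p 1) (p 2) (p 3) (SC * Y 0) (SC * Y 1) (SC * Y 2) := by
    intro j hj
    have hd := two_mul_dist_sq y (R (wPt j))
    rw [← hYdef, himg j, sub_dotProduct, dotProduct_sub, dotProduct_sub, hYY, dot_mulVec_self hO, FZ_dot_self hj,
      dotProduct_comm (M *ᵥ fun a => (FZ j a : ℝ)) Y] at hd
    have h1' : 1 ≤ dist y (R (wPt j)) ^ 2 := by nlinarith [hyM j hj]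
    have hYM : Y ⬝ᵥ (M *ᵥ fun a => (FZ j a : ℝ)) ≤ 1 := by linarith
    have hNF : ∀ a, NF j a (p 0) (p 1) (p 2) (p 3) = n * (M *ᵥ fun b => (FZ j b : ℝ)) a := by
      intro a; rw [NF_eq_mulVec, hN, Matrix.smul_mulVec]; rfl
    rw [hNF 0, hNF 1, hNF 2]
    simp only [dotProduct, Fin.sum_univ_three] at hYM
    have : n * (SC * ((M *ᵥ fun b => (FZ j b : ℝ)) 0 * Y 0 + (M *ᵥ fun b => (FZ j b : ℝ)) 1 * Y 1 +
        (M *ᵥ fun b => (FZ j b : ℝ)) 2 * Y 2)) ≤ n * (SC * 1) :=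
      mul_le_mul_of_nonneg_left (mul_le_mul_of_nonneg_left (by linarith) hS.le) hn.le
    linarith [this]
  -- the ball
  obtain ⟨cert, hcert, hball⟩ := G hsph h1 h3 h4
  refine hfar cert hcert ?_
  obtain ⟨-, -, -, hBB⟩ := certOK_spec (certOK_of_mem allCertOK_ok hcert)
  have hB : cert.bR * cert.bRᵀ = 1 := by
    ext a b
    simp only [Matrix.mul_apply, Matrix.transpose_apply, DTCert.bR, Matrix.of_apply, Matrix.one_apply, Fin.sum_univ_three]
    have := hBB a b
    simp only [Fin.sum_univ_three] at this
    exact this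
  have hB' : cert.bRᵀ * cert.bR = 1 := mul_eq_one_comm.1 hB
  have hfrob := frob_orth hO' hB'
  unfold InCertBall
  unfold Ball at hball
  have hsum : 2 * (∑ a : Fin 3, ∑ b : Fin 3, ((cert.B a b : ℚ) : ℝ) * quatMat (p 0) (p 1) (p 2) (p 3) a b) / n =
      2 * ∑ a : Fin 3, ∑ b : Fin 3, M a b * cert.bR a b := by
    rw [hN, div_eq_iff hn.ne']
    simp only [Matrix.smul_apply, smul_eq_mul, DTCert.bR, Matrix.of_apply, Finset.mul_sum, Finset.sum_mul]
    refine Finset.sum_congr rfl fun a _ => Finset.sum_congr rfl fun b _ => ?_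
    ring
  rw [hsum, ← hfrob] at hball
  by_cases hu : cert.useY
  · rw [if_pos hu] at hball ⊢
    have hYt : (SC * Y 0 / SC - ((cert.y0 0 : ℚ) : ℝ)) ^ 2 + (SC * Y 1 / SC - ((cert.y0 1 : ℚ) : ℝ)) ^ 2 +
        (SC * Y 2 / SC - ((cert.y0 2 : ℚ) : ℝ)) ^ 2 = 2 * ‖y - cert.y0E‖ ^ 2 := by
      rw [← sqrt_two_smul_cubicCoords_dot_self, cubicCoords_sub, smul_sub, ← hYdef,
        NearIdentity.DTCert.sqrt_two_smul_cubicCoords_y0E]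
      simp only [dotProduct, Fin.sum_univ_three, Pi.sub_apply, DTCert.y0R, castVec]
      field_simp
    rw [hYt] at hball
    exact hball
  · rw [if_neg hu] at hball ⊢
    exact hball

/-! ### The improper case and the theorem -/

/-- `det (cubicMat R) = ±1`. -/
theorem det_cubicMat_sq (R : EuclideanSpace ℝ (Fin 3) ≃ₗᵢ[ℝ] EuclideanSpace ℝ (Fin 3)) :
    (cubicMat R).det = 1 ∨ (cubicMat R).det = -1 := by
  have h := congrArg Matrix.det (cubicMat_orth R)
  rw [Matrix.det_mul, Matrix.det_transpose, Matrix.det_one] at h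
  exact mul_self_eq_one_iff.1 h

/-- The bond mirror `swapMirror` is improper: `det = −1`. -/
theorem det_cubicMat_swapMirror : (cubicMat swapMirror).det = -1 := by
  rw [swapMirror, cubicMat_bondReflection]
  simp [Matrix.det_fin_three, castMat, mirrorQ, slotInt]

/-- **`StarPairFar` holds** (computational grade: eight `native_decide` evaluations of the self-recomputing branch and
bound + `allCertOK_ok`; the rest on the standard axioms). -/
theorem starPairFar_holds : StarPairFar := by
  intro R y hclus hy hyF hyM hfar1 hfar2
  rcases det_cubicMat_sq R with hdet | hdet
  · exact false_of_proper R y hdet hclus hy hyF hyM hfar1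
  · set R' := swapMirror.trans R with hR'
    have hR'app : ∀ v, R' v = R (swapMirror v) := fun v => rfl
    have hdet' : (cubicMat R').det = 1 := by
      rw [hR', cubicMat_trans, Matrix.det_mul, hdet, det_cubicMat_swapMirror]; norm_num
    have hclus' : ∀ i ∈ starIdx, ∀ j ∈ starIdx, wPt i = R' (wPt j) ∨ 1 ≤ dist (wPt i) (R' (wPt j)) := by
      intro i hi j hj; rw [hR'app, swapMirror_wPt]; exact hclus i hi _ (swapPerm_mem_starIdx j hj)
    have hyM' : ∀ j ∈ starIdx, 1 ≤ dist y (R' (wPt j)) := by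
      intro j hj; rw [hR'app, swapMirror_wPt]; exact hyM _ (swapPerm_mem_starIdx j hj)
    exact false_of_proper R' y hdet' hclus' hy hyF hyM' hfar2

/-- Hence the stars-only double-star input of the localised stack ledger: **`StarPairCoaxial` holds**. -/
theorem starPairCoaxial_holds : StarPairCoaxial := starPairCoaxial_of_far starPairFar_holds

end Summit.Ventures.Crystal3D.Theorems.StarFar
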